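import Summits.AtomisticToContinuum.Crystallization.Theorems.FluxCellKepler.Negative.LayeredMinimiser

/-!
# `FluxCellKepler` (stmt-AtomisticToContinuum-15221), negative side II
# — witness constraints and the balanced-pair (LP) kill criterion

Continues `Negative/LayeredMinimiser.lean` (`Dom`, `Kepler`, `floor`, `witness_energy_eq_eStar`);
the unit vector `e0` is the tree's (`ChargedEnergyGap/Negative/FarCopies`).

* One- and two-point configurations squeeze the isolated-pattern value of any witness:
  `d⁻⁶ ≤ τ {0} ≤ −12 e(P₀)` for all `d > R₁`, so `0 < R₁` (`Dom.R₁_pos`), `e(P₀) < 0`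
  (`witness_energy_neg`) and `R₁⁻⁶ ≤ −12 e(P₀)` (`witness_R₁_bound`): the pattern radius of a local
  tail credit is at least `(12|e⋆|)^{-1/6} ≈ 0.70`.
* `not_fluxCellKepler_of_balanced`: the certified obstruction form of the `c = 0` part — two
  families of finite injective configurations with the same `R₁`-pattern multiset and an `r⁻⁶`
  surplus over `½ Σ site₁₂ − 12 N e⋆` refute the crux (by LP duality over the pattern values this
  is the ONLY way the `c = 0` part can fail; on paper it is dead for every `R₁ ≳ 0.5`).

Nothing here asserts a route statement; `--supports` the crux.  All `[folklore]`.
-/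

noncomputable section

namespace Summit.AtomisticToContinuum.Crystallization.Theorems.FluxCellKepler.Negative

open scoped BigOperators
open Literature.MathematicalPhysics.StatisticalMechanics
open Summit.AtomisticToContinuum.Crystallization.Theses.FluxTubeKepler

/-! ## Patterns -/

/-- The `R₁`-pattern of site `i`: relative positions of the particles within `R₁` (the argument of
`τ` in the crux, verbatim). [folklore] -/
def pat (R₁ : ℝ) {N : ℕ} (x : Fin N → E3) (i : Fin N) : Finset E3 :=
  (Finset.univ.filter fun j : Fin N => dist (x j) (x i) ≤ R₁).image fun j => x j - x i

/-! ## Witness constraints from one- and two-point configurations -/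

open Summit.AtomisticToContinuum.Crystallization.Theorems.ChargedEnergyGapNegative (e0 norm_e0)

/-- The two-point configuration `0, d e₀`. [folklore] -/
def twoPt (d : ℝ) : Fin 2 → E3 := ![0, d • e0]

/-- First point of `twoPt`. [folklore] -/
theorem twoPt_zero (d : ℝ) : twoPt d 0 = 0 := rfl
/-- Second point of `twoPt`. [folklore] -/
theorem twoPt_one (d : ℝ) : twoPt d 1 = d • e0 := rfl

/-- The two points are at distance `d`. [folklore] -/
theorem dist_twoPt {d : ℝ} (hd : 0 ≤ d) : dist (twoPt d 0) (twoPt d 1) = d := by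
  rw [twoPt_zero, twoPt_one, dist_comm, dist_zero_right, norm_smul, norm_e0, mul_one,
    Real.norm_of_nonneg hd]

/-- Distinct points of the two-point configuration are at distance `d`. [folklore] -/
theorem dist_twoPt_ne {d : ℝ} (hd : 0 ≤ d) :
    ∀ i j : Fin 2, i ≠ j → dist (twoPt d i) (twoPt d j) = d := by
  simp only [Fin.forall_fin_two]
  refine ⟨⟨fun h => absurd rfl h, fun _ => dist_twoPt hd⟩,
    ⟨fun _ => by rw [dist_comm]; exact dist_twoPt hd, fun h => absurd rfl h⟩⟩

/-- `twoPt d` is injective for `d > 0`. [folklore] -/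
theorem twoPt_injective {d : ℝ} (hd : 0 < d) : Function.Injective (twoPt d) := by
  intro i j h
  by_contra hne
  have := dist_twoPt_ne hd.le i j hne
  rw [h, dist_self] at this
  exact hd.ne' (this.symm ▸ rfl)

/-- The pattern of an isolated site: `{0}` if `0 ≤ R₁`, `∅` otherwise. [folklore] -/
def isoPat (R₁ : ℝ) : Finset E3 := if 0 ≤ R₁ then {0} else ∅

/-- In the two-point configuration at distance `d > R₁` both patterns are the isolated pattern.
[folklore] -/
theorem pat_twoPt {R₁ d : ℝ} (hd : 0 < d) (hRd : R₁ < d) (i : Fin 2) :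
    ((Finset.univ.filter fun j : Fin 2 => dist (twoPt d j) (twoPt d i) ≤ R₁).image
      fun j => twoPt d j - twoPt d i) = isoPat R₁ := by
  by_cases hR : 0 ≤ R₁
  · have hfilter : (Finset.univ.filter fun j : Fin 2 => dist (twoPt d j) (twoPt d i) ≤ R₁) =
        {i} := by
      ext j
      simp only [Finset.mem_filter, Finset.mem_univ, true_and, Finset.mem_singleton]
      constructor
      · intro hj
        by_contra hne
        have := dist_twoPt_ne hd.le j i hne
        linarith
      · rintro rfl
        simpa using hR
    rw [hfilter, Finset.image_singleton, sub_self]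
    simp [isoPat, hR]
  · have hfilter : (Finset.univ.filter fun j : Fin 2 => dist (twoPt d j) (twoPt d i) ≤ R₁) =
        ∅ := by
      ext j
      simp only [Finset.mem_filter, Finset.mem_univ, true_and, Finset.notMem_empty, iff_false,
        not_le]
      exact (not_le.1 hR).trans_le dist_nonneg
    rw [hfilter, Finset.image_empty]
    simp [isoPat, hR]

/-- Site energies of the two-point configuration for an inverse-power potential. [folklore] -/
theorem siteEnergy_twoPt {d : ℝ} (hd : 0 < d) (n : ℕ) :
    ∀ i : Fin 2, siteEnergy (fun r => (r⁻¹) ^ n) (twoPt d) i = (d⁻¹) ^ n := by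
  unfold siteEnergy
  have h0 : (Finset.univ.erase (0 : Fin 2)) = {1} := by decide
  have h1 : (Finset.univ.erase (1 : Fin 2)) = {0} := by decide
  simp only [Fin.forall_fin_two, h0, h1, Finset.sum_singleton]
  rw [dist_comm (twoPt d 1), dist_twoPt hd.le]
  exact ⟨rfl, rfl⟩

/-- **DOM on two points at distance `d > R₁`:** `d⁻⁶ ≤ τ (isoPat R₁)`. [folklore] -/
theorem Dom.inv_pow_six_le {R₁ : ℝ} {τ : Finset E3 → ℝ} (h : Dom R₁ τ) {d : ℝ} (hd : 0 < d)
    (hRd : R₁ < d) : (d⁻¹) ^ 6 ≤ τ (isoPat R₁) := by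
  have := h 2 (twoPt d) (twoPt_injective hd)
  simp only [Fin.sum_univ_two, siteEnergy_twoPt hd, pat_twoPt hd hRd] at this
  linarith

/-- **Any DOM-witness has `0 < R₁`**: otherwise all small two-point configurations have the
isolated pattern and `d⁻⁶ ≤ τ(isoPat)` for all small `d`, absurd. [folklore] -/
theorem Dom.R₁_pos {R₁ : ℝ} {τ : Finset E3 → ℝ} (h : Dom R₁ τ) : 0 < R₁ := by
  by_contra hR
  push Not at hR
  set T := τ (isoPat R₁)
  set d : ℝ := 1 / (|T| + 2) with hd_def
  have hT2 : 0 < |T| + 2 := by positivity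
  have hd : 0 < d := by positivity
  have hd1 : d ≤ 1 := by
    rw [hd_def, div_le_one hT2]; linarith [abs_nonneg T]
  have h1 : (d⁻¹) ^ 6 ≤ T := h.inv_pow_six_le hd (hR.trans_lt hd)
  have h2 : d⁻¹ ≤ (d⁻¹) ^ 6 := le_self_pow₀ (one_le_inv₀ hd |>.2 hd1) (by norm_num)
  have h3 : d⁻¹ = |T| + 2 := by rw [hd_def, one_div, inv_inv]
  linarith [le_abs_self T]

/-- With `0 ≤ R₁` the isolated pattern is `{0}`. [folklore] -/
theorem isoPat_of_nonneg {R₁ : ℝ} (h : 0 ≤ R₁) : isoPat R₁ = {0} := by simp [isoPat, h]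

/-- **DOM squeeze, lower side:** `d⁻⁶ ≤ τ {0}` for every `d > R₁`. [folklore] -/
theorem Dom.inv_pow_six_le_tau_zero {R₁ : ℝ} {τ : Finset E3 → ℝ} (h : Dom R₁ τ) {d : ℝ}
    (hRd : R₁ < d) : (d⁻¹) ^ 6 ≤ τ {0} := by
  have hR := h.R₁_pos
  rw [← isoPat_of_nonneg hR.le]
  exact h.inv_pow_six_le (hR.trans hRd) hRd

/-- The one-point configuration. [folklore] -/
def onePt : Fin 1 → E3 := fun _ => 0

/-- **KEPLER on one point:** the right-hand side of KEPLER is non-negative on every injective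
configuration (it is `δ`-separated for its own `δ`), and on the single site it reads
`τ {0} / 12 ≤ -e(P₀)`. [folklore] -/
theorem Kepler.tau_zero_le {P₀ : PeriodicConfiguration 3} {R₁ : ℝ} {τ : Finset E3 → ℝ}
    (h : Kepler P₀ R₁ τ) (hR : 0 ≤ R₁) :
    τ {0} ≤ -12 * P₀.energyPerParticle lennardJones := by
  obtain ⟨c, hc, hK⟩ := h 1 one_pos 1 1 one_pos one_pos
  have hinj : Function.Injective onePt := fun i j _ => Subsingleton.elim i j
  have hsep : ∀ i j : Fin 1, i ≠ j → (1 : ℝ) ≤ dist (onePt i) (onePt j) :=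
    fun i j hij => absurd (Subsingleton.elim i j) hij
  have h0 := le_trans (mul_nonneg hc.le (Nat.cast_nonneg _)) (hK 1 onePt hinj hsep)
  have hfilt : (Finset.univ.filter fun j : Fin 1 => dist (onePt j) (onePt 0) ≤ R₁) =
      Finset.univ := by
    ext j; simp [onePt, hR]
  have hpat : ((Finset.univ.filter fun j : Fin 1 => dist (onePt j) (onePt 0) ≤ R₁).image
      fun j => onePt j - onePt 0) = {0} := by
    rw [hfilt]; ext p; simp [onePt]
  have hsite : siteEnergy (fun r => (r⁻¹) ^ 12) onePt 0 = 0 := by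
    unfold siteEnergy
    have : (Finset.univ.erase (0 : Fin 1)) = ∅ := by decide
    rw [this, Finset.sum_empty]
  simp only [Fin.sum_univ_one, hsite, mul_zero, zero_sub, Nat.cast_one, one_mul, hpat] at h0
  linarith

/-- **Any witness has negative energy per particle** (`e(P₀) < 0`). [folklore] -/
theorem witness_energy_neg {P₀ : PeriodicConfiguration 3} {R₁ : ℝ} {τ : Finset E3 → ℝ}
    (hD : Dom R₁ τ) (hK : Kepler P₀ R₁ τ) : P₀.energyPerParticle lennardJones < 0 := by
  have hR := hD.R₁_pos
  have h1 := hD.inv_pow_six_le_tau_zero (lt_add_one R₁)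
  have h2 := hK.tau_zero_le hR.le
  have h3 : 0 < ((R₁ + 1)⁻¹) ^ 6 := by positivity
  linarith

/-- **Any witness has `R₁⁻⁶ ≤ -12 e(P₀)`**, i.e. `R₁ ≥ (12|e(P₀)|)^{-1/6}`: the pattern radius of a
local tail credit is bounded below by the energy scale (≈ 0.70 at `e(P₀) = e⋆ ≈ −0.7176`).
[folklore] -/
theorem witness_R₁_bound {P₀ : PeriodicConfiguration 3} {R₁ : ℝ} {τ : Finset E3 → ℝ}
    (hD : Dom R₁ τ) (hK : Kepler P₀ R₁ τ) :
    (R₁⁻¹) ^ 6 ≤ -12 * P₀.energyPerParticle lennardJones := by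
  have hR := hD.R₁_pos
  have h2 := hK.tau_zero_le hR.le
  have hcont : ContinuousAt (fun d : ℝ => (d⁻¹) ^ 6) R₁ := (continuousAt_inv₀ hR.ne').pow 6
  have htend : Filter.Tendsto (fun d : ℝ => (d⁻¹) ^ 6) (nhdsWithin R₁ (Set.Ioi R₁))
      (nhds ((R₁⁻¹) ^ 6)) := hcont.continuousWithinAt.tendsto
  refine le_of_tendsto htend ?_
  refine eventually_nhdsWithin_of_forall fun d hd => ?_
  exact (hD.inv_pow_six_le_tau_zero hd).trans h2

/-! ## The LP / balanced-ensemble kill criterion (certified obstruction form)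

With `c = 0` the two conjuncts squeeze `T(x) := Σ_i τ(pattern_i(x))` between
`L(x) := Σ_i site₆(x)_i` (DOM) and `U(x) := ½ Σ_i site₁₂(x)_i − 12 N e(P₀)` (KEPLER, `rhs_nonneg`),
and `T` is ADDITIVE over the multiset of patterns.  So X is refuted by two finite families of
configurations with the same pattern multiset (a "balanced pair") whose `L`-total on one side
exceeds the `U`-total on the other (`e(P₀) = e⋆` for any witness).  By LP duality over the pattern
values this is also the ONLY way the `c = 0` part can fail; on paper every balanced pair reduces to
assemblies of the same pieces across gaps `> R₁`, whose far-`r⁻⁶` surplus (≤ `πρ²/(12 R₁²)` per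
unit facing area) loses to `12 ×` the surface energy of the pieces for every `R₁ ≳ 0.5` — and
`R₁ ≥ (12|e⋆|)^{-1/6}` is forced (`witness_R₁_bound`).  Recorded here so that a future witness only
has to be plugged in. -/

/-- A finite family of finite configurations (sizes may differ). [folklore] -/
abbrev Family : Type := List (Σ N : ℕ, Fin N → E3)

/-- The pattern multiset of a family at radius `R₁`. [folklore] -/
def patterns (R₁ : ℝ) (X : Family) : Multiset (Finset E3) :=
  (X.map fun c => (Finset.univ.val.map fun i => pat R₁ c.2 i)).sum

/-- `Σ τ(pattern)` over a family is a function of its pattern multiset. [folklore] -/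
theorem sum_tau_eq (R₁ : ℝ) (τ : Finset E3 → ℝ) (X : Family) :
    (X.map fun c => ∑ i, τ (pat R₁ c.2 i)).sum = ((patterns R₁ X).map τ).sum := by
  induction X with
  | nil => simp [patterns]
  | cons c X ih =>
    simp only [List.map_cons, List.sum_cons, patterns, Multiset.map_add, Multiset.sum_add] at ih ⊢
    rw [ih]
    congr 1
    rw [Multiset.map_map, Finset.sum_eq_multiset_sum]
    rfl

open Summit.AtomisticToContinuum.Crystallization.Theorems.ChargedEnergyGapNegative in
/-- **Kill criterion (balanced pairs).** If for every `R₁ > 0` there are two families `X, Y` of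
finite injective configurations with the same `R₁`-pattern multiset and
`Σ_Y (½ Σ site₁₂ − 12 N e⋆) < Σ_X Σ site₆`, then `FluxCellKepler` is false. [folklore] -/
theorem not_fluxCellKepler_of_balanced
    (h : ∀ R₁ : ℝ, 0 < R₁ → ∃ X Y : Family, (∀ c ∈ X, Function.Injective c.2) ∧
      (∀ c ∈ Y, Function.Injective c.2) ∧ patterns R₁ X = patterns R₁ Y ∧
      (Y.map fun c => (1 / 2 : ℝ) * ∑ i, siteEnergy (fun r => (r⁻¹) ^ 12) c.2 i -
        12 * (c.1 : ℝ) * eStar).sum <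
      (X.map fun c => ∑ i, siteEnergy (fun r => (r⁻¹) ^ 6) c.2 i).sum) :
    ¬ FluxCellKepler := by
  rw [fluxCellKepler_iff]
  rintro ⟨P₀, R₁, τ, hD, hK⟩
  obtain ⟨X, Y, hX, hY, hbal, hlt⟩ := h R₁ hD.R₁_pos
  have he := witness_energy_eq_eStar hD hK
  -- DOM on the X side
  have h1 : (X.map fun c => ∑ i, siteEnergy (fun r => (r⁻¹) ^ 6) c.2 i).sum ≤
      (X.map fun c => ∑ i, τ (pat R₁ c.2 i)).sum :=
    List.sum_le_sum fun c hc => hD c.1 c.2 (hX c hc)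
  -- KEPLER (`rhs_nonneg`) on the Y side
  have h2 : (Y.map fun c => ∑ i, τ (pat R₁ c.2 i)).sum ≤
      (Y.map fun c => (1 / 2 : ℝ) * ∑ i, siteEnergy (fun r => (r⁻¹) ^ 12) c.2 i -
        12 * (c.1 : ℝ) * eStar).sum := by
    refine List.sum_le_sum fun c hc => ?_
    have h0 := hK.rhs_nonneg (hY c hc)
    rw [Finset.sum_sub_distrib, ← Finset.mul_sum, ← Finset.mul_sum, he] at h0
    change _ ≤ (1 / 24 : ℝ) * _ - (1 / 12 : ℝ) * ∑ i, τ (pat R₁ c.2 i) - _ at h0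
    linarith
  rw [sum_tau_eq, hbal, ← sum_tau_eq] at h1
  linarith

end Summit.AtomisticToContinuum.Crystallization.Theorems.FluxCellKepler.Negative

end
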